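import Literature.RepresentationTheory.VerySimpleRepresentations
import Literature.Geometry.Kaehler.ComplexTorusMaximalPicardNumberCM
import Literature.Geometry.Kaehler.ComplexTorusTateModuleHom
import Mathlib.RingTheory.Localization.Module
import HarnessLib

/-!
# A very simple `ℓ`-torsion module forces `End(X) = ℤ` (Dolgachev–Zarhin, Theorem 2.15, at torus level)

Layer `Literature/Geometry/Kaehler`, namespace `Literature.Geometry.Kaehler.ComplexTorus`; lane
`lit-hodgefound` (Track 2 foundations library), row «Q635⁺ · Q694⁺ · A1-17⁺» of seat p11 (gen 8), FILE 2
of 2 — the sequel of `Literature/RepresentationTheory/VerySimpleRepresentations.lean` (Zarhin's very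
simple `G`-modules: `IsNormalSubalgebra`, `IsVerySimple`). Two plumbing definitions with bodies
(`reduceModHom ℓ : M_ι(ℤ) →+* End_{𝔽_ℓ}(𝔽_ℓ^ι)`, reduction modulo `ℓ` of the rational representation, and
`endModImage Φ ℓ = End(X)/ℓ ⊂ End_{𝔽_ℓ}(X[ℓ])`); everything else is a THEOREM; no named fact (net debt 0).

## Source READ (held text), verbatim

I. Dolgachev, Yu. G. Zarhin, *Endomorphisms of Complex Abelian Varieties* (notes dated 31 July 2024; bib
`DolgachevZarhin2024`; held text `paper:galaxy-pdf-8712177384607648460`), §2.1–§2.2: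

* (2.14), p0031 L30–L36: "`ρ_{n,A,K}(σ) End(A)/n ρ_{n,A,K}(σ)⁻¹ ⊂ End(A)/n.` […] We will mainly be
  interested in the case when `n = ℓ` is a prime number, i.e., when `ℤ/n = 𝔽_ℓ` is a field." and Remark
  2.11 (p0031 L23): "we identify `End(A)/n` with its (isomorphic) image in `End_{ℤ/n}(A[n])`".
* Examples 2.13 (p0032 L3): "1. Obviously, `End_k(𝒱)` and `k·Id` are normal subalgebras. We call them
  obvious normal subalgebras. 2. Let `A` be an abelian variety of positive dimension that is defined over
  a field `K`. Let `ℓ` be a prime number, `𝒱 = A[ℓ]`, `G = Gal(K)`, `ρ = ρ_{A,ℓ,K}`. It follows from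
  (2.14) that `End(A)/ℓ` is a normal subalgebra of `End_{𝔽_ℓ}(A[ℓ])`."
* **Theorem 2.15** (p0032 L25 – p0033 L1): "Let `A` be an abelian variety of positive dimension defined
  over a field `K`. Let `ℓ` be a prime, `k = 𝔽_ℓ`, `𝒱 = A[ℓ]`, `G = Gal(K)`, `ρ = ρ_{A,ℓ,K}`. If the
  `G`-module `A[ℓ]` is very simple, then `End(A) = ℤ`. In particular, `A` is a simple abelian variety.
  *Proof.* Combining Example 2.13 with the definition of very simplicity, we conclude that `End(A)/ℓ` is
  either `𝔽_ℓ·Id`, or `End_{𝔽_ℓ}(A[ℓ])`. This implies that the `𝔽_ℓ`-dimension of `End(A)/ℓ` is either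
  `1`, or `4 dim(A)²`. Since `End(A)` is a free `ℤ`-module, its rank is either `1` or `4 dim(A)²`. In the
  former case, `End(A) = ℤ` and we are done. In the latter case, the rank of `End(A)` is strictly greater
  than `2 dim(A)²`, that contradicts Theorem 2.29 below. This ends the proof."
* *Remark* 2.16 (p0033 L3): "Recall that `dim_{𝔽_ℓ}(A[ℓ]) = 2 dim(A)`. In particular, if `dim(A) = 1`
  (i.e., `A` is an elliptic curve) then `dim_{𝔽_ℓ}(A[ℓ]) = 2`. In light of Remark 2.14(5), the
  conditions of Theorem 2.15 are not fulfilled if `dim(A) = 1` and `ℓ = 2`."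
* Theorem 2.29 (p0055 L7): "the rank of the free abelian group `Hom(A, B)` does not exceed
  `2 dim(A) dim(B)`. In particular, for any abelian variety `A`, `dim_ℚ(End_ℚ(A)) ≤ 2 dim(A)²`." — in the
  tree for every complex torus: `finrank_endAlgRat_le_two_mul_sq` (`ComplexTorusMaximalPicardNumberCM`,
  Beauville's Prop. 3), consumed BY NAME.

## Statement formalised — THE MECHANISM OF THEOREM 2.15 AT TORUS LEVEL, and the recorded deviation

For a complex torus `X = E/Φ(ℤ^ι)` of positive dimension (`ι` nonempty) and a prime `ℓ`, the group of
`ℓ`-division points is `X[ℓ] = X_ℓ ≃ (ℤ/ℓ)^ι` (Lange Prop. 1.1.14, the tree's `divisionPointsEquiv`), and an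
endomorphism `f = ρ_r(A) ∈ End(X) = endRingInt Φ` (an integer matrix) acts on it through `A mod ℓ`
(`divisionPointsEquiv_mapMatrix`, §1). So `End(X)/ℓ ⊂ End_{𝔽_ℓ}(X[ℓ])` is the subalgebra
`endModImage Φ ℓ` of `End_{𝔽_ℓ}((ℤ/ℓ)^ι)` of the reductions of `End(X)`. **Theorem**
(`endRingInt_eq_bot_of_isVerySimple`, `endAlgRat_eq_bot_of_isVerySimple`): for ANY group `G` and ANY
representation `ρ : G → Aut_{𝔽_ℓ}(X[ℓ])` for which `End(X)/ℓ` is `G`-normal (property (2.14)), if the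
`G`-module `X[ℓ]` is very simple then `End(X) = ℤ` (`endRingInt Φ = ⊥`, the scalar integer matrices;
`End_ℚ(X) = ℚ`).

`TODO(printed setting)`: in print `G = Gal(K)` and `ρ = ρ_{A,ℓ,K}` for an abelian variety `A` defined over
a field `K ⊂ ℂ`, and (2.14) is Example 2.13.2; the Galois action on torsion requires a model of `X` over
`K`, which the analytic carrier `ComplexTorus Φ` does not have (lane note of seat p11 gen 7, INBOX l.3049)
— so (2.14) enters as the hypothesis `IsNormalSubalgebra ρ (endModImage Φ ℓ)`, which is exactly what the
printed proof uses. Nothing of the source is strengthened: the proof below is the printed one, with its two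
cases made explicit for complex tori —

* `End(X)/ℓ = 𝔽_ℓ·Id` ⇒ `End(X) = ℤ` (§2, `eq_smul_one_of_forall_reduceMod_mem_bot`): an `f ∈ End(X)`
  congruent to a scalar modulo `ℓ` is, after subtracting an integer, divisible by `ℓ` in `M_ι(ℤ)`, hence in
  `End(X)` (`End(X)` is saturated in `M_ι(ℤ)` — the tree's `mem_endRingInt_of_smul_mem`, Milne §12 — BY NAME), and `ℓ`-adic descent on the
  size of the entries ends at `0` ("`End(A)` is a free `ℤ`-module, its rank is `1` … `End(A) = ℤ`");
* `End(X)/ℓ = End_{𝔽_ℓ}(X[ℓ])` is impossible (§3): lifting the `|ι|²` matrix units gives `|ι|²` elements of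
  `End(X)` that are linearly independent over `ℚ` (independence modulo `ℓ` ⇒ over `ℤ` by the same descent ⇒
  over `ℚ`, `LinearIndependent.iff_fractionRing`), so `rk End(X) ≥ |ι|² = 4 dim(X)² > 2 dim(X)²`,
  contradicting Theorem 2.29 (`finrank_endAlgRat_le_two_mul_sq`).

Also: Remark 2.16 (`not_isVerySimple_divisionPoints_of_card_eq_two`: for `dim X = 1` and `ℓ = 2` the
hypothesis never holds, by Remark 2.14 (5) of FILE 1), and "In particular, `A` is simple" in the form
`End_ℚ(X) = ℚ` (a torus with `End_ℚ(X) = ℚ` has no complex subtorus `0 ≠ Y ≠ X` admitting a complement —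
for abelian varieties, Poincaré: the lane's `isSimple` files; not restated here).

## References

* [DolgachevZarhin2024] I. Dolgachev, Yu. G. Zarhin, *Endomorphisms of Complex Abelian Varieties* (2024),
  §2.1 (2.14), Rem. 2.11; §2.2 Ex. 2.13, Thm. 2.15, Rem. 2.16; §2.5 Thm. 2.29 (held text p0031–p0033, p0055).
* [Zarhin2002VerySimple] Yu. G. Zarhin, *Very simple 2-adic representations and hyperelliptic Jacobians*,
  Mosc. Math. J. 2 (2002), §4 Def. 4.1 (the notion; FILE 1).
* [Lange2023AbelianVarietiesComplex] H. Lange, *Abelian Varieties over the Complex Numbers* (2023), §1.1.2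
  Prop. 1.1.14 (`X_n ≃ (ℤ/nℤ)^{2g}`; the tree's `divisionPointsEquiv`).
* [Beauville2014MaximalPicard] A. Beauville, *Some surfaces with maximal Picard number* (2014), §3 Prop. 3
  (`rk End(X) ≤ 2g²`; the tree's `finrank_endAlgRat_le_two_mul_sq`).
-/

noncomputable section

open Module Matrix Function
open Literature.RepresentationTheory

namespace Literature.Geometry.Kaehler

namespace ComplexTorus

variable {ι : Type*} [Fintype ι] [DecidableEq ι] {E : Type*} [NormedAddCommGroup E] [NormedSpace ℂ E]
  (Φ : (ι → ℝ) ≃L[ℝ] E)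

/-! ## §1 `X[ℓ] = (ℤ/ℓ)^ι` as an `End(X)`-module: reduction of the rational representation modulo `ℓ` -/

section Reduction

variable (ℓ : ℕ)

/-- **Reduction modulo `ℓ` of the rational representation**: `M_ι(ℤ) → End_{ℤ/ℓ}((ℤ/ℓ)^ι)`,
`A ↦ (x ↦ (A mod ℓ) x)` — the map `End(A) → End(A)/n ⊂ End_{ℤ/n}(A[n])` of Remark 2.11 on matrices
(that it IS the action on `X[ℓ]`: `divisionPointsEquiv_mapMatrix`). A ring homomorphism.
[cite: DolgachevZarhin2024, §2.1 Remark 2.11 and (2.14)] -/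
def reduceModHom : Matrix ι ι ℤ →+* Module.End (ZMod ℓ) (ι → ZMod ℓ) :=
  (Matrix.toLinAlgEquiv' : Matrix ι ι (ZMod ℓ) ≃ₐ[ZMod ℓ] Module.End (ZMod ℓ) (ι → ZMod ℓ)).toRingEquiv
    |>.toRingHom.comp (Int.castRingHom (ZMod ℓ)).mapMatrix

/-- `reduceModHom ℓ A = toLin' (A mod ℓ)`. [cite: DolgachevZarhin2024, §2.1 Remark 2.11] -/
theorem reduceModHom_apply (A : Matrix ι ι ℤ) :
    reduceModHom ℓ A = Matrix.toLin' (A.map (Int.cast : ℤ → ZMod ℓ)) := rfl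

/-- `reduceModHom ℓ A x = (A mod ℓ) x`. [cite: DolgachevZarhin2024, §2.1 Remark 2.11] -/
theorem reduceModHom_apply_apply (A : Matrix ι ι ℤ) (x : ι → ZMod ℓ) :
    reduceModHom ℓ A x = A.map (Int.cast : ℤ → ZMod ℓ) *ᵥ x := by
  rw [reduceModHom_apply, Matrix.toLin'_apply]

/-- `reduceModHom ℓ A = reduceModHom ℓ B` iff `A ≡ B (mod ℓ)` entrywise. [folklore] -/
private theorem reduceModHom_eq_iff (A B : Matrix ι ι ℤ) :
    reduceModHom ℓ A = reduceModHom ℓ B ↔ ∀ i j, (ℓ : ℤ) ∣ A i j - B i j := by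
  rw [reduceModHom_apply, reduceModHom_apply, Matrix.toLin'.injective.eq_iff, ← Matrix.ext_iff]
  simp only [Matrix.map_apply, ZMod.intCast_eq_intCast_iff_dvd_sub]
  exact forall₂_congr fun i j ↦ dvd_sub_comm

/-- `reduceModHom ℓ (c • 1) = c·Id`. [folklore] -/
private theorem reduceModHom_smul_one (c : ℤ) :
    reduceModHom ℓ (c • (1 : Matrix ι ι ℤ)) = algebraMap (ZMod ℓ) (Module.End (ZMod ℓ) (ι → ZMod ℓ)) c := by
  rw [reduceModHom_apply, Algebra.algebraMap_eq_smul_one]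
  have : (c • (1 : Matrix ι ι ℤ)).map (Int.cast : ℤ → ZMod ℓ) = (c : ZMod ℓ) • (1 : Matrix ι ι (ZMod ℓ)) := by
    ext i j
    simp only [Matrix.map_apply, Matrix.smul_apply, smul_eq_mul, Int.cast_mul, Matrix.one_apply]
    split_ifs <;> simp
  rw [this, map_smul, Matrix.toLin'_one]
  rfl

/-- **`End(X)/ℓ ⊂ End_{𝔽_ℓ}(X[ℓ])`** (Remark 2.11 / Example 2.13.2's algebra): the `𝔽_ℓ`-subalgebra of
`End_{𝔽_ℓ}((ℤ/ℓ)^ι)` of the reductions `f mod ℓ`, `f ∈ End(X) = endRingInt Φ` (the scalars `c·Id` are the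
reductions of `c·1_X ∈ End(X)`). [cite: DolgachevZarhin2024, §2.1 Remark 2.11 and §2.2 Examples 2.13 (2)] -/
def endModImage : Subalgebra (ZMod ℓ) (Module.End (ZMod ℓ) (ι → ZMod ℓ)) :=
  { ((endRingInt Φ).map (reduceModHom ℓ)).toSubsemiring with
    algebraMap_mem' := fun c ↦ by
      refine ⟨(c.cast : ℤ) • 1, zsmul_mem (Subring.one_mem _) _, ?_⟩
      rw [reduceModHom_smul_one, ZMod.intCast_zmod_cast] }

/-- Membership in `End(X)/ℓ`: the reductions of the `f ∈ End(X)`.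
[cite: DolgachevZarhin2024, §2.1 Remark 2.11] -/
theorem mem_endModImage_iff {f : Module.End (ZMod ℓ) (ι → ZMod ℓ)} :
    f ∈ endModImage Φ ℓ ↔ ∃ A ∈ endRingInt Φ, reduceModHom ℓ A = f :=
  Subring.mem_map

/-- `f mod ℓ ∈ End(X)/ℓ` for `f ∈ End(X)`. [cite: DolgachevZarhin2024, §2.1 Remark 2.11] -/
theorem reduceModHom_mem_endModImage {A : Matrix ι ι ℤ} (hA : A ∈ endRingInt Φ) :
    reduceModHom ℓ A ∈ endModImage Φ ℓ :=
  (mem_endModImage_iff Φ ℓ).2 ⟨A, hA, rfl⟩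

end Reduction

section DivisionPoints

/-- An endomorphism `ρ(A)` maps `X_n = Ker n_X` into itself (`n · ρ(A) t = ρ(A)(n · t) = 0`). Universe-
polymorphic form (in `ι`, `E`) of the tree's `mapMatrix_mem_ker_smul_one` (`ComplexTorusTorsionPointsHomology`,
stated there for `ι : Type`), which is the one to use when `ι : Type`.
[cite: Lange2023AbelianVarietiesComplex, §1.1.2 Prop. 1.1.14] -/
theorem mem_ker_smul_one_mapMatrix (A : Matrix ι ι ℤ) {n : ℤ} {t : ComplexTorus Φ}
    (ht : t ∈ (mapMatrixHom Φ Φ (n • (1 : Matrix ι ι ℤ))).ker) :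
    mapMatrix Φ Φ A t ∈ (mapMatrixHom Φ Φ (n • (1 : Matrix ι ι ℤ))).ker := by
  rw [mem_ker_mapMatrixHom_smul_one_iff] at ht ⊢
  rw [← mapMatrixHom_apply, ← map_zsmul, ht, map_zero]

/-- **`End(X)` acts on `X_n ≃ (ℤ/nℤ)^{2g}` through `ρ_r mod n`**: under Lange's isomorphism
`X_n ≃ (ℤ/nℤ)^ι` (`divisionPointsEquiv`, Prop. 1.1.14: `π(m/n) ↦ m mod n`) the restriction of `ρ(A)` to
`X_n` is `x ↦ (A mod n) x` — the identification "`End(A)/n` with its image in `End_{ℤ/n}(A[n])`" of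
Remark 2.11. [cite: DolgachevZarhin2024, §2.1 Remark 2.11] [cite: Lange2023AbelianVarietiesComplex, §1.1.2 Prop. 1.1.14] -/
theorem divisionPointsEquiv_mapMatrix {n : ℤ} (hn : n ≠ 0) (A : Matrix ι ι ℤ)
    (t : (mapMatrixHom Φ Φ (n • (1 : Matrix ι ι ℤ))).ker) :
    divisionPointsEquiv Φ hn ⟨mapMatrix Φ Φ A t, mem_ker_smul_one_mapMatrix Φ A t.2⟩ =
      A.map (Int.cast : ℤ → ZMod n.natAbs) *ᵥ divisionPointsEquiv Φ hn t := by
  obtain ⟨m, rfl⟩ := kerLatticeHomRestrict_surjective Φ Φ (det_smul_one_ne_zero hn) t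
  have hAt : (⟨mapMatrix Φ Φ A (kerLatticeHomRestrict Φ Φ (det_smul_one_ne_zero hn) m),
      mem_ker_smul_one_mapMatrix Φ A (kerLatticeHomRestrict Φ Φ (det_smul_one_ne_zero hn) m).2⟩ :
        (mapMatrixHom Φ Φ (n • (1 : Matrix ι ι ℤ))).ker) =
      kerLatticeHomRestrict Φ Φ (det_smul_one_ne_zero hn) (A *ᵥ m) := by
    refine Subtype.ext ?_
    change mapMatrix Φ Φ A (kerLatticeHomRestrict Φ Φ (det_smul_one_ne_zero hn) m : ComplexTorus Φ) =
      (kerLatticeHomRestrict Φ Φ (det_smul_one_ne_zero hn) (A *ᵥ m) : ComplexTorus Φ)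
    rw [coe_kerLatticeHomRestrict_smul_one Φ hn, coe_kerLatticeHomRestrict_smul_one Φ hn, mapMatrix_proj]
    congr 1
    funext i
    simp only [Matrix.mulVec, dotProduct, Matrix.map_apply, Int.cast_sum, Int.cast_mul, Finset.sum_div,
      mul_div_assoc]
  rw [hAt, divisionPointsEquiv_kerLatticeHomRestrict, divisionPointsEquiv_kerLatticeHomRestrict]
  funext i
  simp only [Matrix.mulVec, dotProduct, Matrix.map_apply, Int.cast_sum, Int.cast_mul]

/-- The same for a prime (or any natural number) `ℓ`: on `X[ℓ] ≃ (ℤ/ℓ)^ι`, `ρ(A)` acts as `reduceModHom ℓ A`.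
[cite: DolgachevZarhin2024, §2.1 Remark 2.11] -/
theorem divisionPointsEquiv_mapMatrix_natCast {ℓ : ℕ} (hℓ : (ℓ : ℤ) ≠ 0) (A : Matrix ι ι ℤ)
    (t : (mapMatrixHom Φ Φ ((ℓ : ℤ) • (1 : Matrix ι ι ℤ))).ker) :
    divisionPointsEquiv Φ hℓ ⟨mapMatrix Φ Φ A t, mem_ker_smul_one_mapMatrix Φ A t.2⟩ =
      reduceModHom ℓ A (divisionPointsEquiv Φ hℓ t) := by
  rw [divisionPointsEquiv_mapMatrix, reduceModHom_apply_apply]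
  rfl

end DivisionPoints

/-! ## §2 First case of the proof: `End(X)/ℓ = 𝔽_ℓ·Id` forces `End(X) = ℤ` -/

section CaseScalars

variable {Φ}

omit [DecidableEq ι] in
/-- The size `Σ |B i j|` of an integer matrix (the descent parameter). [folklore] -/
private theorem sum_natAbs_eq_zero_iff (B : Matrix ι ι ℤ) :
    ∑ p : ι × ι, (B p.1 p.2).natAbs = 0 ↔ B = 0 := by
  rw [Finset.sum_eq_zero_iff, ← Matrix.ext_iff]
  simp only [Finset.mem_univ, forall_const, Int.natAbs_eq_zero, Prod.forall, Matrix.zero_apply]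

omit [DecidableEq ι] in
/-- An integer matrix all of whose entries are divisible by `ℓ` is `ℓ · B'`, and the sizes compare:
`Σ|B| = ℓ · Σ|B'|`. [folklore] -/
private theorem exists_eq_smul_of_forall_dvd {ℓ : ℕ} {B : Matrix ι ι ℤ} (h : ∀ i j, (ℓ : ℤ) ∣ B i j) :
    ∃ B' : Matrix ι ι ℤ, B = (ℓ : ℤ) • B' ∧
      ∑ p : ι × ι, (B p.1 p.2).natAbs = ℓ * ∑ p : ι × ι, (B' p.1 p.2).natAbs := by
  choose q hq using h
  refine ⟨Matrix.of q, ?_, ?_⟩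
  · ext i j
    simp [hq i j]
  · rw [Finset.mul_sum]
    refine Finset.sum_congr rfl fun p _ ↦ ?_
    rw [hq p.1 p.2, Int.natAbs_mul, Int.natAbs_natCast, Matrix.of_apply]

/-- **`End(X)/ℓ = 𝔽_ℓ·Id` ⇒ `End(X) = ℤ`, the descent**: if every `f ∈ End(X)` is a scalar modulo the
prime `ℓ`, then an `f ∈ End(X)` with a vanishing diagonal entry `f_{i₀i₀} = 0` is `0` — it is `≡ 0 (mod ℓ)`,
so `f = ℓ f'` with `f' ∈ End(X)` (saturation) of smaller size, and induction. ("Since `End(A)` is a free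
`ℤ`-module, its rank is … `1` … `End(A) = ℤ`".) [cite: DolgachevZarhin2024, §2.2 Theorem 2.15 (proof, first case)] -/
theorem eq_zero_of_forall_reduceMod_mem_bot {ℓ : ℕ} [Fact ℓ.Prime]
    (h : ∀ A ∈ endRingInt Φ, reduceModHom ℓ A ∈ (⊥ : Subalgebra (ZMod ℓ) (Module.End (ZMod ℓ) (ι → ZMod ℓ))))
    (i₀ : ι) {B : Matrix ι ι ℤ} (hB : B ∈ endRingInt Φ) (hB₀ : B i₀ i₀ = 0) : B = 0 := by
  -- strong induction on the size `N = Σ |B i j|`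
  suffices key : ∀ N : ℕ, ∀ B : Matrix ι ι ℤ, B ∈ endRingInt Φ → B i₀ i₀ = 0 →
      ∑ p : ι × ι, (B p.1 p.2).natAbs = N → B = 0 from key _ B hB hB₀ rfl
  intro N
  induction N using Nat.strong_induction_on with
  | _ N ih =>
    intro B hB hB₀ hN
    -- `B ≡ c · 1 (mod ℓ)` with `c = B i₀ i₀ = 0`, so `ℓ ∣ B`
    obtain ⟨c, hc⟩ := Algebra.mem_bot.1 (h B hB)
    have hc' : reduceModHom ℓ B = reduceModHom ℓ ((c.val : ℤ) • 1) := by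
      rw [reduceModHom_smul_one, Int.cast_natCast, ZMod.natCast_zmod_val, hc]
    rw [reduceModHom_eq_iff] at hc'
    have hc0 : (ℓ : ℤ) ∣ (c.val : ℤ) := by
      have := hc' i₀ i₀
      rwa [hB₀, Matrix.smul_apply, Matrix.one_apply_eq, smul_eq_mul, mul_one, zero_sub, dvd_neg] at this
    have hdvd : ∀ i j, (ℓ : ℤ) ∣ B i j := fun i j ↦ by
      have hij := hc' i j
      by_cases hd : i = j
      · subst hd
        rw [Matrix.smul_apply, Matrix.one_apply_eq, smul_eq_mul, mul_one] at hij
        simpa using hij.add hc0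
      · rwa [Matrix.smul_apply, Matrix.one_apply_ne hd, smul_zero, sub_zero] at hij
    obtain ⟨B', rfl, hsize⟩ := exists_eq_smul_of_forall_dvd hdvd
    have hℓ : (ℓ : ℤ) ≠ 0 := Nat.cast_ne_zero.2 (Fact.out : ℓ.Prime).ne_zero
    have hB' : B' ∈ endRingInt Φ := mem_endRingInt_of_smul_mem Φ hℓ hB
    have hℓn : ℓ ≠ 0 := (Fact.out : ℓ.Prime).ne_zero
    have hB'₀ : B' i₀ i₀ = 0 := by
      simpa [hℓn] using hB₀
    by_cases hzero : ∑ p : ι × ι, (B' p.1 p.2).natAbs = 0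
    · rw [(sum_natAbs_eq_zero_iff B').1 hzero, smul_zero]
    · -- the size drops: `Σ|B'| < ℓ Σ|B'| = Σ|B| = N`
      have hlt : ∑ p : ι × ι, (B' p.1 p.2).natAbs < N := by
        rw [← hN, hsize]
        exact lt_mul_left (Nat.pos_of_ne_zero hzero) (Fact.out : ℓ.Prime).one_lt
      rw [ih _ hlt B' hB' hB'₀ rfl, smul_zero]

/-- **`End(X)/ℓ = 𝔽_ℓ·Id` ⇒ `End(X) = ℤ`**: every `f ∈ End(X)` is an integer, `f = f_{i₀i₀} · 1_X`
(apply the descent to `f - f_{i₀i₀}·1`). [cite: DolgachevZarhin2024, §2.2 Theorem 2.15 (proof, first case)] -/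
theorem eq_smul_one_of_forall_reduceMod_mem_bot {ℓ : ℕ} [Fact ℓ.Prime]
    (h : ∀ A ∈ endRingInt Φ, reduceModHom ℓ A ∈ (⊥ : Subalgebra (ZMod ℓ) (Module.End (ZMod ℓ) (ι → ZMod ℓ))))
    (i₀ : ι) {A : Matrix ι ι ℤ} (hA : A ∈ endRingInt Φ) : A = A i₀ i₀ • (1 : Matrix ι ι ℤ) := by
  have hB : A - A i₀ i₀ • (1 : Matrix ι ι ℤ) ∈ endRingInt Φ :=
    sub_mem hA (zsmul_mem (Subring.one_mem _) _)
  have := eq_zero_of_forall_reduceMod_mem_bot h i₀ hB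
    (by rw [Matrix.sub_apply, Matrix.smul_apply, Matrix.one_apply_eq, smul_eq_mul, mul_one, sub_self])
  rwa [sub_eq_zero] at this

end CaseScalars

/-! ## §3 Second case of the proof: `End(X)/ℓ = End_{𝔽_ℓ}(X[ℓ])` contradicts `rk End(X) ≤ 2 dim(X)²` -/

section CaseAll

variable {Φ}

omit [DecidableEq ι] in
/-- **Independence modulo `ℓ` lifts to `ℤ`** (the rank count "the `𝔽_ℓ`-dimension of `End(A)/ℓ` … its
rank"): a finite family of integer matrices such that every integer relation has all coefficients divisible
by `ℓ > 1` is linearly independent over `ℤ` (`ℓ`-adic descent on `Σ|c_p|`). [cite: DolgachevZarhin2024, §2.2 Theorem 2.15 (proof, second case)] -/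
theorem linearIndependent_int_of_forall_dvd {κ : Type*} [Fintype κ] {ℓ : ℕ} (hℓ : 1 < ℓ)
    {A : κ → Matrix ι ι ℤ} (h : ∀ c : κ → ℤ, ∑ p, c p • A p = 0 → ∀ p, (ℓ : ℤ) ∣ c p) :
    LinearIndependent ℤ A := by
  rw [Fintype.linearIndependent_iff]
  suffices key : ∀ N : ℕ, ∀ c : κ → ℤ, ∑ p, c p • A p = 0 → ∑ p, (c p).natAbs = N → ∀ p, c p = 0 from
    fun c hc ↦ key _ c hc rfl
  intro N
  induction N using Nat.strong_induction_on with
  | _ N ih =>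
    intro c hc hN
    choose c' hc' using h c hc
    have hcc' : c = fun p ↦ (ℓ : ℤ) * c' p := funext hc'
    have hℓ0 : (ℓ : ℤ) ≠ 0 := by exact_mod_cast (Nat.lt_of_succ_lt hℓ).ne'
    -- the relation for `c'`: `ℓ • Σ c'_p A_p = 0`
    have hc'rel : ∑ p, c' p • A p = 0 := by
      have : (ℓ : ℤ) • ∑ p, c' p • A p = 0 := by
        rw [Finset.smul_sum]
        simpa only [hcc', smul_smul] using hc
      exact (smul_eq_zero.1 this).resolve_left hℓ0
    by_cases hzero : ∑ p, (c' p).natAbs = 0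
    · intro p
      have hp : c' p = 0 := by
        simpa using (Finset.sum_eq_zero_iff.1 hzero) p (Finset.mem_univ p)
      rw [hc' p, hp, mul_zero]
    · have hsize : ∑ p, (c p).natAbs = ℓ * ∑ p, (c' p).natAbs := by
        rw [Finset.mul_sum]
        exact Finset.sum_congr rfl fun p _ ↦ by rw [hc' p, Int.natAbs_mul, Int.natAbs_natCast]
      have hlt : ∑ p, (c' p).natAbs < N := by
        rw [← hN, hsize]
        exact lt_mul_left (Nat.pos_of_ne_zero hzero) hℓ
      intro p
      rw [hc' p, ih _ hlt c' hc'rel rfl p, mul_zero]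

/-- **Over `ℚ`**: such a family, read in `M_ι(ℚ)`, is linearly independent over `ℚ`
(`ℤ`-independence ⇒ `ℚ`-independence, `LinearIndependent.iff_fractionRing`).
[cite: DolgachevZarhin2024, §2.2 Theorem 2.15 (proof, second case)] -/
theorem linearIndependent_rat_of_forall_dvd {κ : Type*} [Fintype κ] {ℓ : ℕ} (hℓ : 1 < ℓ)
    {A : κ → Matrix ι ι ℤ} (h : ∀ c : κ → ℤ, ∑ p, c p • A p = 0 → ∀ p, (ℓ : ℤ) ∣ c p) :
    LinearIndependent ℚ fun p ↦ (A p).map (Int.cast : ℤ → ℚ) := by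
  have hZ := linearIndependent_int_of_forall_dvd hℓ h
  -- push along the injective `ℤ`-linear map `M_ι(ℤ) → M_ι(ℚ)`
  let F : Matrix ι ι ℤ →ₗ[ℤ] Matrix ι ι ℚ := ((Int.castRingHom ℚ).mapMatrix : Matrix ι ι ℤ →+* Matrix ι ι ℚ).toIntLinearMap
  have hF : LinearMap.ker F = ⊥ := by
    rw [LinearMap.ker_eq_bot]
    intro X Y hXY
    ext i j
    have := congr($(hXY) i j)
    simpa [F] using this
  have hZ' : LinearIndependent ℤ (F ∘ A) := hZ.map' F hF
  exact (LinearIndependent.iff_fractionRing ℤ ℚ).1 hZ'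

variable (Φ)

/-- **`End(X)/ℓ = End_{𝔽_ℓ}(X[ℓ])` is impossible for `X ≠ 0`**: if every `𝔽_ℓ`-endomorphism of
`(ℤ/ℓ)^ι` is the reduction of some `f ∈ End(X)`, lift the matrix units `E_{ij}`; the `|ι|²` lifts are
linearly independent over `ℚ` (a relation, reduced mod `ℓ`, is a relation among the `E_{ij}`), so
`rk End(X) ≥ |ι|² = 4 dim(X)²`, "strictly greater than `2 dim(A)²`, that contradicts Theorem 2.29".
[cite: DolgachevZarhin2024, §2.2 Theorem 2.15 (proof, second case)] -/
theorem endModImage_ne_top [Nonempty ι] [FiniteDimensional ℂ E] {ℓ : ℕ} [Fact ℓ.Prime] :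
    endModImage Φ ℓ ≠ ⊤ := by
  intro htop
  have hℓ1 : 1 < ℓ := (Fact.out : ℓ.Prime).one_lt
  -- lift the matrix units
  have hlift : ∀ p : ι × ι, ∃ A ∈ endRingInt Φ,
      reduceModHom ℓ A = Matrix.toLin' (Matrix.single p.1 p.2 (1 : ZMod ℓ)) := fun p ↦
    (mem_endModImage_iff Φ ℓ).1 (htop ▸ Algebra.mem_top)
  choose A hA hAred using hlift
  have hAmod : ∀ p : ι × ι, (A p).map (Int.cast : ℤ → ZMod ℓ) = Matrix.single p.1 p.2 1 := fun p ↦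
    Matrix.toLin'.injective (by rw [← reduceModHom_apply, hAred])
  -- every integer relation among the `A p` has coefficients divisible by `ℓ`
  have hdvd : ∀ c : ι × ι → ℤ, ∑ p, c p • A p = 0 → ∀ p, (ℓ : ℤ) ∣ c p := by
    intro c hc p
    have h2 : ∀ q : ι × ι, ((A q p.1 p.2 : ℤ) : ZMod ℓ) = if q = p then 1 else 0 := fun q ↦ by
      have := congr($(hAmod q) p.1 p.2)
      rw [Matrix.map_apply] at this
      rw [this, Matrix.single_apply]
      by_cases hq : q = p
      · subst hq; simp
      · have : ¬ (q.1 = p.1 ∧ q.2 = p.2) := fun hh ↦ hq (Prod.ext hh.1 hh.2)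
        rw [if_neg this, if_neg hq]
    have h1 : (((∑ q, c q • A q) p.1 p.2 : ℤ) : ZMod ℓ) = 0 := by rw [hc, Matrix.zero_apply, Int.cast_zero]
    rw [Matrix.sum_apply] at h1
    simp only [Matrix.smul_apply, smul_eq_mul, Int.cast_sum, Int.cast_mul, h2, mul_ite, mul_one, mul_zero,
      Finset.sum_ite_eq', Finset.mem_univ, if_true] at h1
    exact (ZMod.intCast_zmod_eq_zero_iff_dvd _ _).1 h1
  have hind := linearIndependent_rat_of_forall_dvd hℓ1 hdvd
  -- the lifts lie in `End_ℚ(X)`; count dimensions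
  have hmem : ∀ p, (A p).map (Int.cast : ℤ → ℚ) ∈ endAlgRat Φ := fun p ↦ (mem_endRingInt_iff Φ).1 (hA p)
  have hind' : LinearIndependent ℚ fun p : ι × ι ↦ (⟨(A p).map (Int.cast : ℤ → ℚ), hmem p⟩ : endAlgRat Φ) :=
    LinearIndependent.of_comp (endAlgRat Φ).val.toLinearMap hind
  have hcard := hind'.fintype_card_le_finrank
  have hle := finrank_endAlgRat_le_two_mul_sq Φ
  rw [Fintype.card_prod] at hcard
  have hι : Fintype.card ι = 2 * finrank ℂ E := card_eq_two_mul_finrank Φ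
  have hpos : 0 < Fintype.card ι := Fintype.card_pos
  nlinarith

end CaseAll

/-! ## §4 Theorem 2.15 (mechanism, at torus level) and Remark 2.16 -/

section Main

variable {Φ}

/-- **Dolgachev–Zarhin, Theorem 2.15 — the mechanism, at torus level.** Let `X = E/Φ(ℤ^ι)` be a complex
torus of positive dimension, `ℓ` a prime, and `ρ : G → Aut_{𝔽_ℓ}(X[ℓ])` a representation of a group `G` on
`X[ℓ] = (ℤ/ℓ)^ι` under which `End(X)/ℓ ⊂ End_{𝔽_ℓ}(X[ℓ])` is `G`-normal (property (2.14); in print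
`G = Gal(K)`, `ρ = ρ_{A,ℓ,K}`, Example 2.13.2). If the `G`-module `X[ℓ]` is very simple, then
`End(X) = ℤ`: every endomorphism is an integer (`endRingInt Φ = ⊥`, the scalar integer matrices).
`-- TODO(printed setting): G = Gal(K), ρ = ρ_{A,ℓ,K} for A/K ⊂ ℂ; no model over K on the analytic carrier.`
[cite: DolgachevZarhin2024, §2.2 Theorem 2.15] -/
theorem endRingInt_eq_bot_of_isVerySimple [Nonempty ι] [FiniteDimensional ℂ E] {ℓ : ℕ} [Fact ℓ.Prime]
    {G : Type*} [Group G] {ρ : Representation (ZMod ℓ) G (ι → ZMod ℓ)}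
    (hnorm : IsNormalSubalgebra ρ (endModImage Φ ℓ)) (hvs : IsVerySimple ρ) : endRingInt Φ = ⊥ := by
  -- "`End(A)/ℓ` is either `𝔽_ℓ·Id`, or `End_{𝔽_ℓ}(A[ℓ])`"; the latter is excluded by §3
  have hbot : endModImage Φ ℓ = ⊥ := (hvs.eq_bot_or_eq_top hnorm).resolve_right (endModImage_ne_top Φ)
  refine le_antisymm (fun A hA ↦ ?_) bot_le
  obtain ⟨i₀⟩ := ‹Nonempty ι›
  have h : ∀ B ∈ endRingInt Φ, reduceModHom ℓ B ∈ (⊥ : Subalgebra (ZMod ℓ) (Module.End (ZMod ℓ) (ι → ZMod ℓ))) :=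
    fun B hB ↦ hbot ▸ reduceModHom_mem_endModImage Φ ℓ hB
  rw [eq_smul_one_of_forall_reduceMod_mem_bot h i₀ hA]
  exact Subring.mem_bot.2 ⟨A i₀ i₀, by rw [zsmul_eq_mul, mul_one]⟩

/-- **Theorem 2.15, "`End(A) = ℤ`" element-wise**: under the same hypotheses every `f ∈ End(X)` is
multiplication by an integer, `ρ_r(f) = n · 1`. [cite: DolgachevZarhin2024, §2.2 Theorem 2.15] -/
theorem exists_eq_smul_one_of_isVerySimple [Nonempty ι] [FiniteDimensional ℂ E] {ℓ : ℕ} [Fact ℓ.Prime]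
    {G : Type*} [Group G] {ρ : Representation (ZMod ℓ) G (ι → ZMod ℓ)}
    (hnorm : IsNormalSubalgebra ρ (endModImage Φ ℓ)) (hvs : IsVerySimple ρ) {A : Matrix ι ι ℤ}
    (hA : A ∈ endRingInt Φ) : ∃ n : ℤ, A = n • (1 : Matrix ι ι ℤ) := by
  have h := endRingInt_eq_bot_of_isVerySimple hnorm hvs ▸ hA
  obtain ⟨n, hn⟩ := Subring.mem_bot.1 h
  exact ⟨n, by rw [← hn, zsmul_eq_mul, mul_one]⟩

/-- **Theorem 2.15 for `End_ℚ(X)`**: under the same hypotheses `End_ℚ(X) = ℚ` (`endAlgRat Φ = ⊥`) — so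
`X` has no endomorphisms beyond `ℤ` ("In particular, `A` is a simple abelian variety": a decomposable one
has non-scalar idempotents in `End_ℚ`). [cite: DolgachevZarhin2024, §2.2 Theorem 2.15] -/
theorem endAlgRat_eq_bot_of_isVerySimple [Nonempty ι] [FiniteDimensional ℂ E] {ℓ : ℕ} [Fact ℓ.Prime]
    {G : Type*} [Group G] {ρ : Representation (ZMod ℓ) G (ι → ZMod ℓ)}
    (hnorm : IsNormalSubalgebra ρ (endModImage Φ ℓ)) (hvs : IsVerySimple ρ) : endAlgRat Φ = ⊥ := by
  refine le_antisymm (fun B hB ↦ ?_) bot_le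
  -- clear denominators: `d • B` is integral, hence in `End(X) = ℤ`
  obtain ⟨d, hd, A, hAB⟩ := exists_intMatrix_map_eq_smul B
  have hA : A ∈ endRingInt Φ := by
    rw [mem_endRingInt_iff, hAB]
    exact (endAlgRat Φ).smul_mem hB _
  obtain ⟨n, rfl⟩ := exists_eq_smul_one_of_isVerySimple hnorm hvs hA
  have hB' : B = ((n : ℚ) / d) • (1 : Matrix ι ι ℚ) := by
    have hd' : (d : ℚ) ≠ 0 := Int.cast_ne_zero.2 hd
    have h1 : (n • (1 : Matrix ι ι ℤ)).map (Int.cast : ℤ → ℚ) = (n : ℚ) • (1 : Matrix ι ι ℚ) := by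
      ext i j
      simp only [Matrix.map_apply, Matrix.smul_apply, Matrix.one_apply, smul_eq_mul, Int.cast_mul, Int.cast_ite,
        Int.cast_one, Int.cast_zero]
    have h2 : (d : ℚ) • B = (n : ℚ) • (1 : Matrix ι ι ℚ) := by
      rw [Int.cast_smul_eq_zsmul ℚ d B, ← hAB, h1]
    calc B = (d : ℚ)⁻¹ • ((d : ℚ) • B) := by rw [smul_smul, inv_mul_cancel₀ hd', one_smul]
      _ = ((n : ℚ) / d) • 1 := by rw [h2, smul_smul, div_eq_inv_mul]
  rw [hB', ← Algebra.algebraMap_eq_smul_one]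
  exact Subalgebra.algebraMap_mem _ _

omit [DecidableEq ι] in
/-- **Remark 2.16**: "if `dim(A) = 1` (i.e., `A` is an elliptic curve) then `dim_{𝔽_ℓ}(A[ℓ]) = 2`. In light
of Remark 2.14(5), the conditions of Theorem 2.15 are not fulfilled if `dim(A) = 1` and `ℓ = 2`": for a
lattice of rank `|ι| = 2` no `G`-module structure on `X[2] = (ℤ/2)^ι` is very simple.
[cite: DolgachevZarhin2024, §2.2 Remark 2.16] -/
theorem not_isVerySimple_divisionPoints_of_card_eq_two (hι : Fintype.card ι = 2) {G : Type*} [Group G]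
    (ρ : Representation (ZMod 2) G (ι → ZMod 2)) : ¬ IsVerySimple ρ :=
  not_isVerySimple_of_finrank_eq_two (by rw [Module.finrank_pi, hι]) ρ

omit [DecidableEq ι] in
/-- Remark 2.16 with the dimension read on `E`: for `dim_ℂ E = 1` (an elliptic curve `X = E/Φ(ℤ^ι)`,
`|ι| = 2`) and `ℓ = 2`, no `G`-module structure on `X[2]` is very simple.
[cite: DolgachevZarhin2024, §2.2 Remark 2.16] -/
theorem not_isVerySimple_divisionPoints_of_finrank_eq_one (Φ : (ι → ℝ) ≃L[ℝ] E) [FiniteDimensional ℂ E]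
    (hE : finrank ℂ E = 1) {G : Type*} [Group G] (ρ : Representation (ZMod 2) G (ι → ZMod 2)) :
    ¬ IsVerySimple ρ :=
  not_isVerySimple_divisionPoints_of_card_eq_two (ι := ι) (by rw [card_eq_two_mul_finrank Φ, hE]) ρ

end Main

end ComplexTorus

end Literature.Geometry.Kaehler

end
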